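import Summits.QuantumFields.BalabanUV.T4Continuum.Support.NE9CurChartLipschitzAtFlat
import Literature.MathematicalPhysics.QuantumFieldTheory.Balaban1983to89.B11Eq98W80ModulusAtFlat
import Literature.MathematicalPhysics.QuantumFieldTheory.Balaban1983to89.B11Eq98V0LettersUniform
import Literature.MathematicalPhysics.QuantumFieldTheory.Balaban1983to89.B11Ineq73KernelLettersUniform

/-!
# NE9CurChartLipschitzAtFlatW80 — THE CHART OF THE CURVE SPECIES `cur U` WITH THE (L3) SLOT INHABITED BY THE GENUINE `W80 = (δ/δA′)V` IS LIPSCHITZ IN THE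
# BACKGROUND AT THE FLAT POINT, AT A FIXED LATTICE: `‖ι(chart_U[W80(U)] B) − chart_1[W80(1)] B‖_(115),∇_1 ≤ K·ε` for every unit-bounded UNITARY small-bond
# background (`‖U(b) − 1‖ ≤ ε ≤ ε₃`) on one ball of block fields — (Z) `Support/NE9CurChartLipschitzAtFlat` with its ONE displayed modulus δ_W DISCHARGED;
# cell `pub-balaban`, T4-DAG §2 node U3 ∕ §6 NE9, WALL-NE9-P1 §3 (ii); BINDER row NE9 (owner lineage `b2b-balaban-t4-ne9-p1`); Summits-side NEW leaf by
# NE9 leaf-05 (`b2b-balaban-t4-ne9-formalise-leaf-05`, gen 71) under the OWNER's OFFER O-ne9p1-g83-3 ∕ INTENT-2 (journal l.44677, re-opened in the OWNER's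
# FINAL INBOX l.36580 and g84's W-2 l.46016: «the (Z)+W80 composition … still open to you») — ruling e34b3e0c (0): a named interface requested by the crux
# prover; nothing printed asserted

HONEST FRAMING (T4-DAG PAGE 1).  Rung (B)+1 of the FINITE-VOLUME T⁴ programme — NOT infinite volume, NOT a mass gap, NOT the Clay problem.  NE9
(`T4OutputRate.NE9` ∧ `FadingMemory`) is a cell NEW ESTIMATE, NOT PRINTED in [I] = [Balaban1987RG1] (CMP **109**), [II] = [Balaban1988RG2Cluster]
(CMP **116**), and NOT PROVED here («NE9 ⇐ the named binders»; spine PROVED 0∕9).  HONEST DEPENDENCY (cell line, verbatim): continuum YM on T⁴ ⇐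
BetaPertH ∧ nine spine estimates (0/9 proved); BetaPertH ⇐ (D1) ∧ (D4) ∧ CAP+tail; G-an2-4 gates asym, D1 and NE2/3/4.  The `cur U` OBJECT is ONE
item of the MODEL O-NE9-1 (species (a) data); the END's `act` ∕ `ker` halves and NEEDS-COORDINATOR #5 are untouched.

WHAT THIS FILE PROVES (ONE theorem; 0 def, 0 sorry, axioms standard).  **`cur_chart_lipschitz_at_flat_W80_unitary`**: for the data of (Z)
(`L ≥ 1`, the norming `φ`, a bounded linear `τ` with `⟨φ⁻¹X, φ⁻¹Y⟩ = τ(X⋆Y)`, tracial; level maps with `1 ≤ lev₀`; `c₀, c₁, a > 0`) and the (L3) slot's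
OWN letters — a bounded dualiser `ρ : (𝔸 →L ℂ) →L 𝔸`, a CONTRACTIVE tracial `*`-trace `τc : 𝔸 →L ℂ`, bounds `M_J, M_Δ ≥ 0` — there are `ε₃ > 0`
(`≤ ε_reg(d, L)`), `ε₄, ε_C`, a constant `K > 0` and a radius `R_b > 0` (finite-lattice numbers) such that for EVERY background `U` with `U(b) ∈ U1`,
`‖U(b) − 1‖ ≤ ε ≤ ε₃`, `U(b)⋆ = U(b)⁻¹`, every `J` (`‖J‖ ≤ M_J`), `Δ_π : Space115(∇_U) →L |·|₍₋₃₎` (`‖Δ_π‖ ≤ M_Δ`) and every block field `B ∈ ball 0 R_b`: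
the positivity `hpos` at `U` and at `1` HOLD and
`‖ι(chartHB 𝔊(U) 0 (W80 ρ τc U H₁(U) C(U) ε_C J Δ_π) 0 (A′ ↦ A′ + solA H₁(U) 0 C(U) 0 ε_C A′) ε₄ H₁(U) B)
  − chartHB 𝔊(1) 0 (W80 ρ τc 1 H₁(1) C(1) ε_C J (Δ_π ∘L ι⁻¹)) 0 (A′ ↦ A′ + solA H₁(1) 0 C(1) 0 ε_C A′) ε₄ H₁(1) B‖ ≤ K·ε`,
`H₁(·) = H1LatticeCLM …`, `𝔊(·) = frakGLatticeCLM …`, `C(·) = Cc …` the chain's letters, `W80` = `B11Eq80Current.W80` (the (80) current `W1 + W2 + W3 +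
curV0full`, Sect. C composition inside), `ι` the jet identity `∇_U → ∇_1`.
MECHANISM — (Z)'s assembly RE-RUN IN THE ORDER THE INHABITATION NEEDS: the chart-level Lipschitz letters `K_G, K_A, K_ι, ε₉`
(`B11Eq174ChartContinuityAtFlat.exists_chartHB_lipschitz_at_flat`) and the letter defects themselves (`B11Eq117LetterDefects.exists_letter_defects_at_flat`,
for `δ_H := K_A·ε`); Thm 3.11 at small field; the uniform `H₁`∕`𝔊` bounds; the `C`-letter's modulus (`δ_C := K_C·ε·r_C`); THEN the Sect. C scalars
(`B11Eq118RegimeScalars.exists_regime_scalars` at `(3C₂, c₄∕3)` under the cap `r_C∕2`); THEN the V₀-slot constant uniformly over unit-ball unitary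
backgrounds (`B11Eq98V0LettersUniform.exists_curV0_quadBound_uniform`), the level geometry (`exists_levelGeometry`), the derivative letters' bound
(`B11Eq117TransformationNorm.norm_nabla115_le`); THEN W80's `(R′, C₄)` AT these Sect. C scalars (`B11Ineq73KernelLettersUniform.exists_quadAnalytic_W80_uniform`);
THEN the W-regime scalars at `(C_G, 3C₄, R′∕3)` under the cap `min a_C (min (a_C∕8) (1∕192))`; THEN the W80 background modulus at the flat point modulo
`δ_H, δ_C` (this lineage's `B11Eq98W80ModulusAtFlat.exists_W80_background_modulus_at_flat`, with `K_ι := 2` from `B11Eq117LetterDefects.norm_jetId(_nabla)_le`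
both ways under `K_j·ε ≤ 1`); THEN (Z)'s tail verbatim — every term carries a factor `ε`.
DISGUISE TEST: composition of landed theorems; no inequality of the series proved; `K` is a finite-lattice number carrying the CRUDE V₀-group constant
(`∝ L^{j_M}`, `j_M = max lev₀`; (38) unused, (39) not summed by parts) — NOT print's uniformity in the LATTICE ([Balaban1985BackgroundPropagators] Thms
3.12∕3.13), NOT analyticity in the background (Thm 3.4 proper), NOT (97)'s «d and L only»; the dualiser `ρ`, the contractive trace `τc`, `J`, `Δ_π` stay the
instancer's letters (for the MODEL meaning `ρ = rieszτ`, `J = J_U`); not NE9.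
Loci (TYPES only): [Balaban1985Variational] (80), (90)–(98), Prop. 6 (117)–(121), (172)–(175); [Balaban1985BackgroundPropagators] (3.1)–(3.5), Thms 3.4, 3.11.
Imports (Z) (for its letter suppliers), `B11Eq98W80ModulusAtFlat`, `B11Eq98V0LettersUniform`, `B11Ineq73KernelLettersUniform`; modifies nothing; heartbeats as (Z).
Value = WALL-NE9-P1 §3 (ii) with the (L3) slot no longer abstract: the chart of `cur U` AT THE GENUINE `W80` depends Lipschitz-continuously on the background at the
flat point, as a kernel theorem with NO displayed modulus; NOT summit progress.
-/

noncomputable section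

open Metric Set

namespace Summit.QuantumFields.BalabanUV.T4Continuum.NE9CurChartLipschitzAtFlatW80

open Literature.MathematicalPhysics.QuantumFieldTheory.Balaban1983to89
open B11Eq103H1Complex B11Eq115Space B11Eq174Chart B11Eq111FrakG
open B13Contraction113 (QuadAnalytic)
open B9Eq319QprimeTorus (fineP)
open B9SectCLatticeCarrier (Bond)
open B4Sect5Torus (TSite)
open B7Prop1Explicit (U1 Wcx boxVec)
open B9Eq315QTorus (perCfg cornerSite QtorusW laplaceAofBackground)
open B9Eq315QTorusOnto (QtorusW_surjective)
open B9Eq310HessianOperator (adTransportW hessOp)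
open B11Eq44COperatorTorus (Cc quadAnalytic_Cc)
open B5Eq172FlatCoercivity (hU1_one hreg_one laplaceAofBackground_one_pos₀)
open B9Eq384RemainderLetters (hRS_one)
open B9Thm311SmallFieldClosed (laplaceAofBackground_pos_of_small_field hRS_of_unitary)
open B9Eq3126H1BoundCLM (exists_H1_frakG_CLM_bound_of_small_field)
open B11Eq118RegimeScalars (exists_twoRegimes_radii_of_bounds_room_cap)
open B11Eq44COperatorModulus (exists_Cc_modulus_at_flat)
open B9Eq335SmallBondsData (perCfg_mem_U1 hreg_of_small_bonds alpha_le_128 alpha_le_64 alphaL_le_half epsReg_pos)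
open B11Eq174ChartContinuityAtFlat (exists_chartHB_lipschitz_at_flat)

open Literature.MathematicalPhysics.QuantumFieldTheory.Balaban1983to89.B11Eq80Current (W80)
open Literature.MathematicalPhysics.QuantumFieldTheory.Balaban1983to89.B11Eq117LetterDefects (exists_letter_defects_at_flat norm_jetId_nabla_le norm_jetId_le norm_nabla115_sub_flat_le)
open Literature.MathematicalPhysics.QuantumFieldTheory.Balaban1983to89.B11Eq98V0LettersUniform (exists_curV0_quadBound_uniform)
open Literature.MathematicalPhysics.QuantumFieldTheory.Balaban1983to89.B11Ineq73KernelLettersUniform (exists_quadAnalytic_W80_uniform)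
open Literature.MathematicalPhysics.QuantumFieldTheory.Balaban1983to89.B11Eq98W80ModulusAtFlat (exists_W80_background_modulus_at_flat)
open Literature.MathematicalPhysics.QuantumFieldTheory.Balaban1983to89.B11Eq117TransformationNorm (norm_nabla115_le)
open Literature.MathematicalPhysics.QuantumFieldTheory.Balaban1983to89.B11Eq118RegimeRadiiUniform (Regime.of_normBound_zeroLinear)
open B11Eq44COperatorTorus (prop4Hyp_Cc)

set_option maxHeartbeats 1600000 in
set_option maxRecDepth 8192 in
/-- **THE CHART OF THE CURVE SPECIES AT THE GENUINE `W80` IS LIPSCHITZ IN THE BACKGROUND AT THE FLAT POINT, ON ONE BALL, FOR EVERY UNIT-BOUNDED UNITARY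
SMALL-BOND BACKGROUND OF A FIXED LATTICE** — see the module header: `‖ι(chart_U[W80(U)] B) − chart_1[W80(1)] B‖ ≤ K·ε` for `‖U(b) − 1‖ ≤ ε ≤ ε₃`,
`B ∈ ball 0 R_b`; (Z)'s displayed δ_W DISCHARGED by this lineage's W80 background-modulus line; every scalar letter, all four regimes at `U` and at `1`, the
`C(U)`-letter's and `H₁(U)`-letter's defects, the positivity `hpos`, `Q onto`, E162's structural binders PRODUCED; the (L3) slot's own letters `ρ, τc, J, Δ_π`
displayed.  NOT print's uniformity in the lattice; CRUDE finite-lattice `K`. [folklore] -/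
theorem cur_chart_lipschitz_at_flat_W80_unitary {d : ℕ} (L : ℕ) [NeZero L] (m : Fin d → ℕ) [∀ i, NeZero (fineP L m i)] (hL : 1 ≤ L)
    {𝔸 : Type*} [NormedRing 𝔸] [NormedAlgebra ℂ 𝔸] [CompleteSpace 𝔸] [NormOneClass 𝔸] [StarRing 𝔸] [NormedStarGroup 𝔸] [StarModule ℂ 𝔸]
    [FiniteDimensional ℂ 𝔸]
    {W : Type*} [NormedAddCommGroup W] [InnerProductSpace ℂ W] [FiniteDimensional ℂ W] (φ : W ≃ₗ[ℂ] 𝔸) {Mφ Mφ' : ℝ} (hMφ : 0 ≤ Mφ)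
    (hMφ' : 0 ≤ Mφ') (hφ : ∀ w, ‖φ w‖ ≤ Mφ * ‖w‖) (hφ' : ∀ X, ‖φ.symm X‖ ≤ Mφ' * ‖X‖)
    (τ : 𝔸 →ₗ[ℂ] ℂ) {Cτ : ℝ} (hτ : ∀ X, ‖τ X‖ ≤ Cτ * ‖X‖) (hCτ : 0 ≤ Cτ)
    (hτφ : ∀ X Y : 𝔸, inner ℂ (φ.symm X) (φ.symm Y) = τ (star X * Y)) (htr : ∀ X Y : 𝔸, τ (X * Y) = τ (Y * X))
    {η : ℝ} [Fact (0 < (L : ℝ))] [Fact (0 < η)] {lev₀ : Bond d (fineP L m) → ℕ} {levB : Bond d m → ℕ} (lev₁ : Bond d (fineP L m) × Fin d → ℕ)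
    (hlev : ∀ b, 1 ≤ lev₀ b) {c₀ c₁ : ℝ} [Fact (0 < c₀)] [Fact (0 < c₁)] {a : ℝ} (ha : 0 < a)
    (ρ : (𝔸 →L[ℂ] ℂ) →L[ℂ] 𝔸) (τc : 𝔸 →L[ℂ] ℂ) (hτc : ∀ a b : 𝔸, τc (a * b) = τc (b * a)) (hτcs : ∀ a : 𝔸, τc (star a) = starRingEnd ℂ (τc a))
    (hτc1 : ∀ X : 𝔸, ‖τc X‖ ≤ ‖X‖) {MJ MΔ : ℝ} (hMJ : 0 ≤ MJ) (hMΔ : 0 ≤ MΔ) :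
    ∃ ε₃ ε₄ εC K Rb : ℝ, 0 < ε₃ ∧ ε₃ ≤ 1 / (256 * ((d : ℝ) + 1) ^ 2 * (L : ℝ) ^ (d + 1)) ∧ 0 < K ∧ 0 < Rb ∧
      ∀ (U : Bond d (fineP L m) → 𝔸ˣ) (hU : ∀ b, U b ∈ U1 𝔸) {ε : ℝ} (hε : 0 ≤ ε)
      (hεr : ε ≤ 1 / (256 * ((d : ℝ) + 1) ^ 2 * (L : ℝ) ^ (d + 1))), ε ≤ ε₃ → ∀ (hUε : ∀ b, ‖(U b : 𝔸) - 1‖ ≤ ε),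
      (∀ b, star (U b : 𝔸) = (((U b)⁻¹ : 𝔸ˣ) : 𝔸)) →
      ∀ (J : NegSize (L : ℝ) η lev₀ 3 𝔸) (Δπ : Space115 (L : ℝ) η lev₀ lev₁ (nabla115 η U) →L[ℂ] NegSize (L : ℝ) η lev₀ 3 𝔸),
        ‖J‖ ≤ MJ → ‖Δπ‖ ≤ MΔ →
      ∀ B ∈ ball (0 : NegSize (L : ℝ) η levB 0 𝔸) Rb,
      ∃ (hpos : ∀ x : BondL2K ℂ d (fineP L m) c₀ W, x ≠ 0 →
          0 < RCLike.re (inner ℂ x (laplaceAofBackground L m hL φ U (alpha_le_64 hL hε hεr) (perCfg_mem_U1 L m hU)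
            (hreg_of_small_bonds L m hU hε hUε) τ η (c₀ := c₀) (c₁ := c₁) a x)))
        (hpos₁ : ∀ x : BondL2K ℂ d (fineP L m) c₀ W, x ≠ 0 →
          0 < RCLike.re (inner ℂ x (laplaceAofBackground L m hL φ (fun _ => 1) (show (0 : ℝ) ≤ 1 / 64 by norm_num) (hU1_one L m) (hreg_one L m)
            τ η (c₀ := c₀) (c₁ := c₁) a x))),
      ‖LinearMap.toContinuousLinearMap
            ((jetLinearEquiv (L : ℝ) η lev₀ lev₁ (nabla115 η (fun _ : Bond d (fineP L m) => (1 : 𝔸ˣ)))).symm.toLinearMap ∘ₗ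
              (jetLinearEquiv (L : ℝ) η lev₀ lev₁ (nabla115 η U)).toLinearMap)
          (chartHB (frakGLatticeCLM (lev₀ := lev₀) φ hpos (QtorusW_surjective L m hL U (alpha_le_64 hL hε hεr) (perCfg_mem_U1 L m hU)
              (hreg_of_small_bonds L m hU hε hUε) (alphaL_le_half hL hεr) φ) lev₁ (nabla115 η U)) 0
            (W80 ρ τc U (H1LatticeCLM (lev₀ := lev₀) (levB := levB) φ hpos (QtorusW_surjective L m hL U (alpha_le_64 hL hε hεr) (perCfg_mem_U1 L m hU)
              (hreg_of_small_bonds L m hU hε hUε) (alphaL_le_half hL hεr) φ) lev₁ (nabla115 η U))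
              (Cc L m η U lev₀ lev₁ (nabla115 η U) levB) εC J Δπ) 0
            (fun A' => A' + solA (H1LatticeCLM (lev₀ := lev₀) (levB := levB) φ hpos (QtorusW_surjective L m hL U (alpha_le_64 hL hε hεr)
              (perCfg_mem_U1 L m hU) (hreg_of_small_bonds L m hU hε hUε) (alphaL_le_half hL hεr) φ) lev₁ (nabla115 η U)) 0
              (Cc L m η U lev₀ lev₁ (nabla115 η U) levB) 0 εC A') ε₄
            (H1LatticeCLM (lev₀ := lev₀) (levB := levB) φ hpos (QtorusW_surjective L m hL U (alpha_le_64 hL hε hεr) (perCfg_mem_U1 L m hU)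
              (hreg_of_small_bonds L m hU hε hUε) (alphaL_le_half hL hεr) φ) lev₁ (nabla115 η U)) B) -
        chartHB (frakGLatticeCLM (lev₀ := lev₀) (Δ₁ := hessOp φ η (fun _ => 1) τ)
              (Q := QtorusW L m hL φ (fun _ => 1) (show (0 : ℝ) ≤ 1 / 64 by norm_num) (hU1_one L m) (hreg_one L m) (c₀ := c₀) (c₁ := c₁))
              φ hpos₁ (QtorusW_surjective L m hL (fun _ => 1) (show (0 : ℝ) ≤ 1 / 64 by norm_num) (hU1_one L m) (hreg_one L m)
                (show 50 * ((d : ℝ) + 1) * (0 : ℝ) * (L : ℝ) ^ d ≤ 1 / 2 by norm_num) φ) lev₁ (nabla115 η fun _ => 1)) 0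
            (W80 ρ τc (fun _ : Bond d (fineP L m) => (1 : 𝔸ˣ)) (H1LatticeCLM (lev₀ := lev₀) (levB := levB) (Δ₁ := hessOp φ η (fun _ => 1) τ)
              (Q := QtorusW L m hL φ (fun _ => 1) (show (0 : ℝ) ≤ 1 / 64 by norm_num) (hU1_one L m) (hreg_one L m) (c₀ := c₀) (c₁ := c₁))
              φ hpos₁ (QtorusW_surjective L m hL (fun _ => 1) (show (0 : ℝ) ≤ 1 / 64 by norm_num) (hU1_one L m) (hreg_one L m)
                (show 50 * ((d : ℝ) + 1) * (0 : ℝ) * (L : ℝ) ^ d ≤ 1 / 2 by norm_num) φ) lev₁ (nabla115 η fun _ => 1))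
              (Cc L m η (fun _ : Bond d (fineP L m) => (1 : 𝔸ˣ)) lev₀ lev₁ (nabla115 η fun _ => 1) levB) εC J
              (Δπ.comp (LinearMap.toContinuousLinearMap ((jetLinearEquiv (L : ℝ) η lev₀ lev₁ (nabla115 η U)).symm.toLinearMap ∘ₗ
                (jetLinearEquiv (L : ℝ) η lev₀ lev₁ (nabla115 η (fun _ : Bond d (fineP L m) => (1 : 𝔸ˣ)))).toLinearMap)))) 0
          (fun A' => A' + solA (H1LatticeCLM (lev₀ := lev₀) (levB := levB) (Δ₁ := hessOp φ η (fun _ => 1) τ)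
              (Q := QtorusW L m hL φ (fun _ => 1) (show (0 : ℝ) ≤ 1 / 64 by norm_num) (hU1_one L m) (hreg_one L m) (c₀ := c₀) (c₁ := c₁))
              φ hpos₁ (QtorusW_surjective L m hL (fun _ => 1) (show (0 : ℝ) ≤ 1 / 64 by norm_num) (hU1_one L m) (hreg_one L m)
                (show 50 * ((d : ℝ) + 1) * (0 : ℝ) * (L : ℝ) ^ d ≤ 1 / 2 by norm_num) φ) lev₁ (nabla115 η fun _ => 1)) 0
            (Cc L m η (fun _ : Bond d (fineP L m) => (1 : 𝔸ˣ)) lev₀ lev₁ (nabla115 η fun _ => 1) levB) 0 εC A') ε₄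
          (H1LatticeCLM (lev₀ := lev₀) (levB := levB) (Δ₁ := hessOp φ η (fun _ => 1) τ)
            (Q := QtorusW L m hL φ (fun _ => 1) (show (0 : ℝ) ≤ 1 / 64 by norm_num) (hU1_one L m) (hreg_one L m) (c₀ := c₀) (c₁ := c₁))
            φ hpos₁ (QtorusW_surjective L m hL (fun _ => 1) (show (0 : ℝ) ≤ 1 / 64 by norm_num) (hU1_one L m) (hreg_one L m)
              (show 50 * ((d : ℝ) + 1) * (0 : ℝ) * (L : ℝ) ^ d ≤ 1 / 2 by norm_num) φ) lev₁ (nabla115 η fun _ => 1)) B‖ ≤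
        K * ε := by
  have hη : η ≠ 0 := ne_of_gt (Fact.out : 0 < η)
  have hL' : (1 : ℝ) ≤ (L : ℝ) := by exact_mod_cast hL
  have hC₂0 : (0 : ℝ) ≤ 2097152 * ((d : ℝ) + 1) ^ 2 := by positivity
  have hc₄0 : (0 : ℝ) < 1 / (512 * ((d : ℝ) + 1)) := by positivity
  obtain ⟨KG, KA, Kι, ε₉, hKG, hKA, hKι, hε₉, HL⟩ :=
    exists_chartHB_lipschitz_at_flat L m hL φ (c₀ := c₀) (c₁ := c₁) (η := η) lev₀ levB lev₁ ha hMφ hMφ' hφ hφ' τ hτ hCτ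
  obtain ⟨KG', KA', ε₉', hKG', hKA', hε₉', HD⟩ :=
    exists_letter_defects_at_flat L m hL φ (c₀ := c₀) (c₁ := c₁) (η := η) lev₀ levB lev₁ ha hMφ hMφ' hφ hφ' τ hτ hCτ
  obtain ⟨ε₃', hε₃', Hpos⟩ := laplaceAofBackground_pos_of_small_field L m hL φ (c₀ := c₀) (c₁ := c₁) hη ha hMφ hMφ' hφ hφ' τ hτ hCτ
  obtain ⟨CH, CG, ε₅, hCH, hCG, hε₅, Hb⟩ :=
    exists_H1_frakG_CLM_bound_of_small_field L m hL φ (c₀ := c₀) (c₁ := c₁) (η := η) lev₀ levB lev₁ ha hMφ hMφ' hφ hφ' τ hτ hCτ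
  obtain ⟨KC, rCm, hKC, hrCm, HC⟩ := exists_Cc_modulus_at_flat L m (η := η) lev₀ lev₁ levB hL (𝔸 := 𝔸)
  obtain ⟨jC, aC, εC, hjC, haC, hεC, hcapC, hCdom, hCself, hCcontr⟩ :=
    B11Eq118RegimeScalars.exists_regime_scalars hCH.le (by positivity : (0 : ℝ) ≤ 3 * (2097152 * ((d : ℝ) + 1) ^ 2))
      (by positivity : (0 : ℝ) < 1 / (512 * ((d : ℝ) + 1)) / 3) (half_pos hrCm)
  have hmC : 0 ≤ εC + aC := by linarith only [hεC, haC]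
  have hcontr4 : 4 * CH * (2097152 * ((d : ℝ) + 1) ^ 2) * (εC + aC) < 1 := by
    nlinarith only [hCcontr, mul_nonneg (mul_nonneg hCH.le hC₂0) hmC]
  have hdom2 : 2 * (εC + aC) ≤ 1 / (512 * ((d : ℝ) + 1)) := by linarith only [hCdom, hc₄0]
  obtain ⟨CV, hCV, HqV⟩ := exists_curV0_quadBound_uniform (L := (L : ℝ)) (η := η) (lev₀ := lev₀) (lev₁ := lev₁) ρ τc hτc hτcs hτc1 hL'
  obtain ⟨Λ, hΛ1, hΛ, -, -⟩ := B11Eq98V0LettersPerLattice.exists_levelGeometry (L := (L : ℝ)) (η := η) lev₀ lev₁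
  have hMD : (0 : ℝ) ≤ 2 * ‖((η : ℂ))⁻¹‖ := by positivity
  obtain ⟨R', hR'0, hR'a, C₄, hC₄, HW80⟩ := exists_quadAnalytic_W80_uniform (d := d) (Pd := fineP L m) (L := (L : ℝ)) (η := η) (lev₀ := lev₀)
    (lev₁ := lev₁) (𝒳 := NegSize (L : ℝ) η levB 0 𝔸) (𝔸 := 𝔸) hCH.le hC₂0 haC hεC.le hdom2 hcontr4 hCV (by norm_num : (0 : ℝ) < 1 / 16)
    (norm_nonneg ρ) (norm_nonneg τc) hMJ (by positivity : 0 ≤ MΔ * 2) hMD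
  obtain ⟨j, a', ε₄, hj, ha', hε₄, hcap, hdom, hself, hcontr⟩ :=
    B11Eq118RegimeScalars.exists_regime_scalars hCG.le (by positivity : 0 ≤ 3 * C₄) (by positivity : 0 < R' / 3)
      (lt_min haC (lt_min (by positivity : 0 < aC / 8) (by norm_num : (0 : ℝ) < 1 / 192)))
  obtain ⟨KW, hKW, HV⟩ := exists_W80_background_modulus_at_flat (d := d) (Pd := fineP L m) (L := (L : ℝ)) (η := η) (lev₀ := lev₀)
    (lev₁ := lev₁) (𝒳 := NegSize (L : ℝ) η levB 0 𝔸) (𝔸 := 𝔸) (c₄ := 1 / (512 * ((d : ℝ) + 1))) (jM := Finset.univ.sup lev₀) haC hεC.le hcontr4 hCV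
    (by norm_num : (0 : ℝ) < 1 / 16) le_rfl (norm_nonneg ρ) (norm_nonneg τc) hMJ hMΔ hMD (by norm_num : (1 : ℝ) ≤ 2) hL' hΛ
    (fun b => Finset.le_sup (Finset.mem_univ b))
  obtain ⟨Kj, hKjdef⟩ : ∃ Kj : ℝ, Kj = (NegSup.wSup (levWeight (L : ℝ) η lev₁ 2) : ℝ) * (2 * ‖((η : ℂ))⁻¹‖) *
      NegSup.wInvSup (levWeight (L : ℝ) η lev₀ 1) + 1 := ⟨_, rfl⟩
  have hKj : 0 < Kj := by rw [hKjdef]; positivity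
  have hm : 0 < ε₄ + a' := by linarith only [hε₄, ha']
  have hmC' : 0 < εC + aC := by linarith only [hεC, haC]
  obtain ⟨D₂, hD₂def⟩ : ∃ D₂ : ℝ, D₂ = 1 - 12 * CG * C₄ * (ε₄ + a') := ⟨_, rfl⟩
  obtain ⟨DC, hDCdef⟩ : ∃ DC : ℝ, DC = 1 - 12 * CH * (2097152 * ((d : ℝ) + 1) ^ 2) * (εC + aC) := ⟨_, rfl⟩
  have hD₂ : 0 < D₂ := by rw [hD₂def]; nlinarith only [hcontr]
  have hDC : 0 < DC := by rw [hDCdef]; nlinarith only [hCcontr]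
  have hD₂1 : D₂ ≤ 1 := by
    rw [hD₂def]; have : 0 ≤ 12 * CG * C₄ * (ε₄ + a') := by positivity
    linarith only [this]
  obtain ⟨Wc, hWcdef⟩ : ∃ Wc : ℝ, Wc = KW * ((KA' * ((2097152 * ((d : ℝ) + 1) ^ 2) * (εC + aC) ^ 2) + CH * (KC * rCm)) / DC +
      (8 * (2097152 * ((d : ℝ) + 1) ^ 2) * KA' + 8 * CH * (KC * rCm) / (εC + aC) ^ 2) * aC ^ 2 +
      524288 * Real.exp 4 * ((d - 1 : ℕ) : ℝ) * Λ ^ 2 * (L : ℝ) ^ (Finset.univ.sup lev₀) * ‖ρ‖ * ‖τc‖ * (1 / 16) ^ 2) := ⟨_, rfl⟩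
  have hWc : 0 ≤ Wc := by rw [hWcdef]; positivity
  obtain ⟨Kn, hKndef⟩ : ∃ Kn : ℝ, Kn = (KG * (j + C₄ * (ε₄ + a') ^ 2) + KA * (a' / (CH + 1)) + CG * Wc) / (DC * D₂) +
      (KA * ((2097152 * ((d : ℝ) + 1) ^ 2) * (εC + aC) ^ 2) + CH * (KC * rCm)) / DC + 1 := ⟨_, rfl⟩
  have hKn : 0 < Kn := by rw [hKndef]; positivity
  refine ⟨min (min (min ε₃' ε₅) (min (min ε₉ ε₉') (min (1 / Kι) (min (1 / Kj) (1 / (256 * ((d : ℝ) + 1) ^ 2 * (L : ℝ) ^ (d + 1)))))))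
      (1 / (12288 * ((2 * (d * L) + L + L : ℕ) : ℝ))),
    ε₄, εC, Kn, a' / (CH + 1),
    lt_min (lt_min (lt_min hε₃' hε₅) (lt_min (lt_min hε₉ hε₉') (lt_min (by positivity) (lt_min (by positivity) (epsReg_pos hL)))))
      (by positivity), ?_, hKn, by positivity, ?_⟩
  · exact (min_le_left _ _).trans ((min_le_right _ _).trans ((min_le_right _ _).trans ((min_le_right _ _).trans (min_le_right _ _))))
  intro U hU ε hε hεr hεm hUε hUstar J Δπ hJ hΔ B hB
  have hεN : ε ≤ 1 / (12288 * ((2 * (d * L) + L + L : ℕ) : ℝ)) := hεm.trans (min_le_right _ _)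
  have hεm' := hεm.trans (min_le_left _ _)
  have hεε₃' : ε ≤ ε₃' := hεm'.trans ((min_le_left _ _).trans (min_le_left _ _))
  have hεε₅ : ε ≤ ε₅ := hεm'.trans ((min_le_left _ _).trans (min_le_right _ _))
  have hεε₉ : ε ≤ ε₉ := hεm'.trans ((min_le_right _ _).trans ((min_le_left _ _).trans (min_le_left _ _)))
  have hεε₉' : ε ≤ ε₉' := hεm'.trans ((min_le_right _ _).trans ((min_le_left _ _).trans (min_le_right _ _)))
  have hεK : ε ≤ 1 / Kι := hεm'.trans ((min_le_right _ _).trans ((min_le_right _ _).trans (min_le_left _ _)))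
  have hεKj : ε ≤ 1 / Kj := hεm'.trans ((min_le_right _ _).trans ((min_le_right _ _).trans ((min_le_right _ _).trans (min_le_left _ _))))
  have hα := alpha_le_128 hL hε hεr
  have hα1 := alpha_le_64 hL hε hεr
  have hU1 := perCfg_mem_U1 L m hU
  have hreg := hreg_of_small_bonds L m hU hε hUε
  have hαL := alphaL_le_half hL hεr
  have hαL0 : 50 * ((d : ℝ) + 1) * (0 : ℝ) * (L : ℝ) ^ d ≤ 1 / 2 := by norm_num
  have hUb : ∀ b : Bond d (fineP L m), ‖(U b : 𝔸)‖ ≤ 1 ∧ ‖(((U b)⁻¹ : 𝔸ˣ) : 𝔸)‖ ≤ 1 := fun b => B7Prop1Explicit.mem_U1.1 (hU b)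
  have hUb₁ : ∀ b : Bond d (fineP L m), ‖(((fun _ : Bond d (fineP L m) => (1 : 𝔸ˣ)) b : 𝔸ˣ) : 𝔸)‖ ≤ 1 ∧
      ‖((((fun _ : Bond d (fineP L m) => (1 : 𝔸ˣ)) b)⁻¹ : 𝔸ˣ) : 𝔸)‖ ≤ 1 := fun _ => ⟨by simp, by simp⟩
  have hRS := hRS_of_unitary φ τ hτφ htr U hUstar
  have hpos := Hpos U hα1 hU1 hreg hε hεε₃' hUε hRS
  have hRS₁ := hRS_one L m φ (𝔸 := 𝔸)
  have hpos₁ := Hpos (fun _ => 1) (show (0 : ℝ) ≤ 1 / 64 by norm_num) (hU1_one L m) (hreg_one L m) le_rfl hε₃'.le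
    (fun b => by simp) hRS₁
  refine ⟨hpos, hpos₁, ?_⟩
  have hQ := QtorusW_surjective L m hL U hα1 hU1 hreg hαL φ (c₀ := c₀) (c₁ := c₁)
  have hQ₁ := QtorusW_surjective L m hL (fun _ : Bond d (fineP L m) => (1 : 𝔸ˣ)) (show (0 : ℝ) ≤ 1 / 64 by norm_num) (hU1_one L m)
    (hreg_one L m) hαL0 φ (c₀ := c₀) (c₁ := c₁)
  obtain ⟨hHU, hGU⟩ := Hb U hα1 hU1 hreg hε hεε₅ hUε hRS hpos hQ
  obtain ⟨hH1, hG1⟩ := Hb (fun _ => 1) (show (0 : ℝ) ≤ 1 / 64 by norm_num) (hU1_one L m) (hreg_one L m) le_rfl hε₅.le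
    (fun b => by simp) hRS₁ hpos₁ hQ₁
  have hGUpt : ∀ f : NegSize (L : ℝ) η lev₀ 3 𝔸,
      ‖frakGLatticeCLM (lev₀ := lev₀) φ hpos hQ lev₁ (nabla115 η U) f‖ ≤ CG * ‖f‖ :=
    fun f => (ContinuousLinearMap.le_opNorm _ f).trans (mul_le_mul_of_nonneg_right hGU (norm_nonneg f))
  have hHUpt : ∀ B : NegSize (L : ℝ) η levB 0 𝔸,
      ‖H1LatticeCLM (lev₀ := lev₀) (levB := levB) φ hpos hQ lev₁ (nabla115 η U) B‖ ≤ CH * ‖B‖ :=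
    fun B => (ContinuousLinearMap.le_opNorm _ B).trans (mul_le_mul_of_nonneg_right hHU (norm_nonneg B))
  have hG1pt : ∀ f : NegSize (L : ℝ) η lev₀ 3 𝔸,
      ‖frakGLatticeCLM (lev₀ := lev₀) φ hpos₁ hQ₁ lev₁ (nabla115 η fun _ => 1) f‖ ≤ CG * ‖f‖ :=
    fun f => (ContinuousLinearMap.le_opNorm _ f).trans (mul_le_mul_of_nonneg_right hG1 (norm_nonneg f))
  have hH1pt : ∀ B : NegSize (L : ℝ) η levB 0 𝔸,
      ‖H1LatticeCLM (lev₀ := lev₀) (levB := levB) φ hpos₁ hQ₁ lev₁ (nabla115 η fun _ => 1) B‖ ≤ CH * ‖B‖ :=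
    fun B => (ContinuousLinearMap.le_opNorm _ B).trans (mul_le_mul_of_nonneg_right hH1 (norm_nonneg B))
  have hCU := quadAnalytic_Cc L m η U lev₀ lev₁ (nabla115 η U) levB hL hα hU1 hreg hlev
  have hC1 := quadAnalytic_Cc L m η (fun _ : Bond d (fineP L m) => (1 : 𝔸ˣ)) lev₀ lev₁ (nabla115 η fun _ => 1) levB hL
    (show (0 : ℝ) ≤ 1 / 128 by norm_num) (hU1_one L m) (hreg_one L m) hlev
  have hCU4 := prop4Hyp_Cc L m η U lev₀ lev₁ (nabla115 η U) levB hL hα hU1 hreg hlev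
  have hC14 := prop4Hyp_Cc L m η (fun _ : Bond d (fineP L m) => (1 : 𝔸ˣ)) lev₀ lev₁ (nabla115 η fun _ => 1) levB hL
    (show (0 : ℝ) ≤ 1 / 128 by norm_num) (hU1_one L m) (hreg_one L m) hlev
  have hCself' : CH * 0 + CH * (2097152 * ((d : ℝ) + 1) ^ 2) * (εC + aC) ^ 2 ≤ εC := by
    have h0 : 0 ≤ CH * jC := mul_nonneg hCH.le hjC.le
    nlinarith only [hCself, h0, mul_nonneg (mul_nonneg hCH.le hC₂0) (sq_nonneg (εC + aC))]
  have hCcontr' : 4 * CH * (2097152 * ((d : ℝ) + 1) ^ 2) * (εC + aC) < 1 := hcontr4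
  have RC₁ := Regime.of_normBound_zeroLinear (H1LatticeCLM (lev₀ := lev₀) (levB := levB) φ hpos hQ lev₁ (nabla115 η U)) hCH.le hHUpt hCU
    hC₂0 hεC.le (by linarith only [hCdom, hc₄0]) hCself' hCcontr'
  have RC₂ := Regime.of_normBound_zeroLinear (H1LatticeCLM (lev₀ := lev₀) (levB := levB) φ hpos₁ hQ₁ lev₁ (nabla115 η fun _ => 1)) hCH.le
    hH1pt hC1 hC₂0 hεC.le (by linarith only [hCdom, hc₄0]) hCself' hCcontr'
  have hDU : ∀ g : Bond d (fineP L m) → 𝔸, ‖nabla115 η U g‖ ≤ 2 * ‖((η : ℂ))⁻¹‖ * ‖g‖ := norm_nabla115_le η U hUb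
  have hD1 : ∀ g : Bond d (fineP L m) → 𝔸, ‖nabla115 η (fun _ : Bond d (fineP L m) => (1 : 𝔸ˣ)) g‖ ≤ 2 * ‖((η : ℂ))⁻¹‖ * ‖g‖ :=
    norm_nabla115_le η _ hUb₁
  have hqVU := HqV U hU hUstar
  have hqV1 := HqV (fun _ : Bond d (fineP L m) => (1 : 𝔸ˣ)) (fun _ => Subgroup.one_mem _) (fun b => by simp)
  have hKjε : Kj * ε ≤ 1 := by
    have h := mul_le_mul_of_nonneg_left hεKj hKj.le
    rwa [mul_one_div_cancel hKj.ne'] at h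
  have hι2 : ∀ f : Space115 (L : ℝ) η lev₀ lev₁ (nabla115 η U),
      ‖LinearMap.toContinuousLinearMap
          ((jetLinearEquiv (L : ℝ) η lev₀ lev₁ (nabla115 η (fun _ : Bond d (fineP L m) => (1 : 𝔸ˣ)))).symm.toLinearMap ∘ₗ
            (jetLinearEquiv (L : ℝ) η lev₀ lev₁ (nabla115 η U)).toLinearMap) f‖ ≤ 2 * ‖f‖ := fun f => by
    refine (norm_jetId_nabla_le L m (η := η) (lev₀ := lev₀) lev₁ U hU hε hUε f).trans (mul_le_mul_of_nonneg_right ?_ (norm_nonneg f))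
    have h0 : (NegSup.wSup (levWeight (L : ℝ) η lev₁ 2) : ℝ) * (2 * ‖((η : ℂ))⁻¹‖ * ε) * NegSup.wInvSup (levWeight (L : ℝ) η lev₀ 1)
        = (Kj - 1) * ε := by rw [hKjdef]; ring
    rw [h0]; nlinarith only [hKjε, hε]
  have hκ2 : ∀ g : Space115 (L : ℝ) η lev₀ lev₁ (nabla115 η (fun _ : Bond d (fineP L m) => (1 : 𝔸ˣ))),
      ‖LinearMap.toContinuousLinearMap
          ((jetLinearEquiv (L : ℝ) η lev₀ lev₁ (nabla115 η U)).symm.toLinearMap ∘ₗ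
            (jetLinearEquiv (L : ℝ) η lev₀ lev₁ (nabla115 η (fun _ : Bond d (fineP L m) => (1 : 𝔸ˣ)))).toLinearMap) g‖ ≤ 2 * ‖g‖ := fun g => by
    have hD : ∀ A : Bond d (fineP L m) → 𝔸, ‖nabla115 η U A - nabla115 η (fun _ : Bond d (fineP L m) => (1 : 𝔸ˣ)) A‖ ≤
        2 * ‖((η : ℂ))⁻¹‖ * ε * ‖A‖ := fun A => by
      rw [norm_sub_rev]; exact norm_nabla115_sub_flat_le η U hU hε hUε A
    refine (norm_jetId_le lev₁ (nabla115 η fun _ : Bond d (fineP L m) => (1 : 𝔸ˣ)) (nabla115 η U) (by positivity) hD g).trans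
      (mul_le_mul_of_nonneg_right ?_ (norm_nonneg g))
    have h0 : (NegSup.wSup (levWeight (L : ℝ) η lev₁ 2) : ℝ) * (2 * ‖((η : ℂ))⁻¹‖ * ε) * NegSup.wInvSup (levWeight (L : ℝ) η lev₀ 1)
        = (Kj - 1) * ε := by rw [hKjdef]; ring
    rw [h0]; nlinarith only [hKjε, hε]
  have hΔ2 : ‖Δπ‖ ≤ MΔ * 2 := hΔ.trans (by linarith only [hMΔ])
  have hΔι : ‖Δπ.comp (LinearMap.toContinuousLinearMap ((jetLinearEquiv (L : ℝ) η lev₀ lev₁ (nabla115 η U)).symm.toLinearMap ∘ₗ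
      (jetLinearEquiv (L : ℝ) η lev₀ lev₁ (nabla115 η (fun _ : Bond d (fineP L m) => (1 : 𝔸ˣ)))).toLinearMap))‖ ≤ MΔ * 2 := by
    refine (ContinuousLinearMap.opNorm_comp_le _ _).trans (mul_le_mul hΔ ?_ (norm_nonneg _) hMΔ)
    exact ContinuousLinearMap.opNorm_le_bound _ (by norm_num) hκ2
  obtain ⟨hW₁, -⟩ := HW80 hDU RC₁ hCU4 ρ τc U le_rfl le_rfl hqVU J Δπ hJ hΔ2
  obtain ⟨hW₂, -⟩ := HW80 hD1 RC₂ hC14 ρ τc (fun _ : Bond d (fineP L m) => (1 : 𝔸ˣ)) le_rfl le_rfl hqV1 J _ hJ hΔι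
  have hself' : CG * j + CG * C₄ * (ε₄ + a') ^ 2 ≤ ε₄ := by
    nlinarith only [hself, mul_nonneg (mul_nonneg hCG.le hC₄) (sq_nonneg (ε₄ + a'))]
  have hcontr' : 4 * CG * C₄ * (ε₄ + a') < 1 := by nlinarith only [hcontr, mul_nonneg (mul_nonneg hCG.le hC₄) hm.le]
  have R₁ := Regime.of_normBound_zeroLinear (frakGLatticeCLM (lev₀ := lev₀) φ hpos hQ lev₁ (nabla115 η U)) hCG.le hGUpt hW₁ hC₄ hε₄.le
    (by linarith only [hdom, hR'0]) hself' hcontr'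
  have R₂ := Regime.of_normBound_zeroLinear (frakGLatticeCLM (lev₀ := lev₀) φ hpos₁ hQ₁ lev₁ (nabla115 η fun _ => 1)) hCG.le hG1pt hW₂ hC₄
    hε₄.le (by linarith only [hdom, hR'0]) hself' hcontr'
  have hBn : ‖B‖ < a' / (CH + 1) := mem_ball_zero_iff.1 hB
  have hBa : CH * ‖B‖ < a' := by
    have : CH * ‖B‖ ≤ CH * (a' / (CH + 1)) := mul_le_mul_of_nonneg_left hBn.le hCH.le
    refine this.trans_lt ?_
    rw [mul_div_assoc', div_lt_iff₀ (by positivity)]; nlinarith only [ha', hCH]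
  have hB₁ : ‖H1LatticeCLM (lev₀ := lev₀) (levB := levB) φ hpos hQ lev₁ (nabla115 η U) B‖ < a' := (hHUpt B).trans_lt hBa
  have hB₂ : ‖H1LatticeCLM (lev₀ := lev₀) (levB := levB) φ hpos₁ hQ₁ lev₁ (nabla115 η fun _ => 1) B‖ < a' := (hH1pt B).trans_lt hBa
  obtain ⟨δC, hδCdef⟩ : ∃ δC : ℝ, δC = KC * ε * rCm := ⟨_, rfl⟩
  have hδC0 : 0 ≤ δC := by rw [hδCdef]; positivity
  have hδC : ∀ P : Space115 (L : ℝ) η lev₀ lev₁ (nabla115 η U), ‖P‖ < εC + aC →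
      ‖Cc L m η U lev₀ lev₁ (nabla115 η U) levB P - Cc L m η (fun _ : Bond d (fineP L m) => (1 : 𝔸ˣ)) lev₀ lev₁ (nabla115 η fun _ => 1) levB
        (LinearMap.toContinuousLinearMap
          ((jetLinearEquiv (L : ℝ) η lev₀ lev₁ (nabla115 η (fun _ : Bond d (fineP L m) => (1 : 𝔸ˣ)))).symm.toLinearMap ∘ₗ
            (jetLinearEquiv (L : ℝ) η lev₀ lev₁ (nabla115 η U)).toLinearMap) P)‖ ≤ δC := fun P hP => by
    have hPr : ‖P‖ < rCm := by linarith only [hP, hcapC, hrCm]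
    refine (HC U hU hε hεN hUε P hPr).trans ?_
    rw [hδCdef]
    exact mul_le_mul_of_nonneg_left hPr.le (by positivity)
  obtain ⟨-, HA⟩ := HD U hα1 hU1 hreg hε hεε₉' hUε hRS hpos hQ hpos₁ hQ₁
  have hra : ε₄ + a' ≤ aC / (2 * (2 : ℝ) ^ 2) := by
    have : ε₄ + a' ≤ aC / 8 := (hcap.trans (min_le_right _ _)).trans (min_le_left _ _)
    linarith only [this]
  have hrV : ε₄ + a' ≤ 1 / 16 / (4 * 2 * (1 / (1 - 4 * CH * (2097152 * ((d : ℝ) + 1) ^ 2) * (εC + aC)))) := by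
    have h1 : ε₄ + a' ≤ 1 / 192 := (hcap.trans (min_le_right _ _)).trans (min_le_right _ _)
    have hq : 2 / 3 ≤ 1 - 4 * CH * (2097152 * ((d : ℝ) + 1) ^ 2) * (εC + aC) := by
      nlinarith only [hCcontr, mul_nonneg (mul_nonneg hCH.le hC₂0) hmC]
    have hq1 : 0 < 1 - 4 * CH * (2097152 * ((d : ℝ) + 1) ^ 2) * (εC + aC) := by linarith only [hq]
    rw [one_div (1 - _), ← div_eq_mul_inv, div_div_eq_mul_div]
    rw [le_div_iff₀ (by positivity)]
    nlinarith only [h1, hq, hq1]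
  have hδW := HV hra hrV hD1 hι2 hκ2 RC₁ hCU4 RC₂ hC14 ρ τc U le_rfl le_rfl hUb hε hUε hqVU hqV1 J Δπ hJ hΔ
    (ρC := 2 * (εC + aC)) (sC := εC + aC) le_rfl (by linarith only [hεC, haC]) (by linarith only [hCdom])
    (by nlinarith only [hCcontr])
    (δH := KA' * ε) (δC := δC) (by positivity) hδC0 HA hδC
  have hKιε : Kι * ε ≤ 1 := by
    have h := mul_le_mul_of_nonneg_left hεK hKι.le
    rwa [mul_one_div_cancel hKι.ne'] at h
  have hρ₁ : (1 + Kι * ε) * (ε₄ + a') ≤ 2 * (ε₄ + a') := by nlinarith only [hKιε, hm]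
  have hρC₁ : (1 + Kι * ε) * (εC + aC) ≤ 2 * (εC + aC) := by nlinarith only [hKιε, hmC']
  have hdom' : 2 * (2 * (ε₄ + a') + (ε₄ + a')) ≤ R' := by linarith only [hdom]
  have hdomC' : 2 * (2 * (εC + aC) + (εC + aC)) ≤ 1 / (512 * ((d : ℝ) + 1)) := by linarith only [hCdom]
  have hκ : 0 + 4 * CG * C₄ * (2 * (ε₄ + a') + (ε₄ + a')) < 1 := by nlinarith only [hcontr]
  have hκC : 4 * CH * (2097152 * ((d : ℝ) + 1) ^ 2) * (2 * (εC + aC) + (εC + aC)) < 1 := by nlinarith only [hCcontr]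
  have hcapA : ε₄ + a' ≤ aC := hcap.trans (min_le_left _ _)
  have hmain := HL U hα1 hU1 hreg hε hεε₉ hUε hRS hpos hQ hpos₁ hQ₁ R₁ R₂ hj.le hj.le B hB₁ hB₂ hδW hρ₁ (by linarith only [hm]) hm hdom' hκ
    RC₁ RC₂ hcapA hcapA hδC hρC₁ (by linarith only [hmC']) hmC' hdomC' hκC
  refine hmain.trans ?_
  have e₂ : 1 - (0 + 4 * CG * C₄ * (2 * (ε₄ + a') + (ε₄ + a'))) = D₂ := by rw [hD₂def]; ring
  have eC : 1 - 4 * CH * (2097152 * ((d : ℝ) + 1) ^ 2) * (2 * (εC + aC) + (εC + aC)) = DC := by rw [hDCdef]; ring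
  rw [e₂, eC]
  have hBRb : ‖B‖ ≤ a' / (CH + 1) := hBn.le
  have hδWle : KW * ((KA' * ε * ((2097152 * ((d : ℝ) + 1) ^ 2) * (εC + aC) ^ 2) + CH * δC) / DC +
      (8 * (2097152 * ((d : ℝ) + 1) ^ 2) * (KA' * ε) + 8 * CH * δC / (εC + aC) ^ 2) * aC ^ 2 +
      524288 * Real.exp 4 * ((d - 1 : ℕ) : ℝ) * Λ ^ 2 * (L : ℝ) ^ (Finset.univ.sup lev₀) * ‖ρ‖ * ‖τc‖ * (1 / 16) ^ 2 * ε) = Wc * ε := by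
    rw [hWcdef, hδCdef]; field_simp
  have hDD : 0 < DC * D₂ := mul_pos hDC hD₂
  have hN₂ : KG * ε * (j + C₄ * (ε₄ + a') ^ 2) + 0 * (ε₄ + a') + CG * (KW * ((KA' * ε * ((2097152 * ((d : ℝ) + 1) ^ 2) * (εC + aC) ^ 2) + CH * δC) / DC +
      (8 * (2097152 * ((d : ℝ) + 1) ^ 2) * (KA' * ε) + 8 * CH * δC / (εC + aC) ^ 2) * aC ^ 2 +
      524288 * Real.exp 4 * ((d - 1 : ℕ) : ℝ) * Λ ^ 2 * (L : ℝ) ^ (Finset.univ.sup lev₀) * ‖ρ‖ * ‖τc‖ * (1 / 16) ^ 2 * ε)) + KA * ε * ‖B‖ ≤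
      (KG * (j + C₄ * (ε₄ + a') ^ 2) + KA * (a' / (CH + 1)) + CG * Wc) * ε := by
    rw [hδWle]
    have h1 : KA * ε * ‖B‖ ≤ KA * ε * (a' / (CH + 1)) := mul_le_mul_of_nonneg_left hBRb (by positivity)
    nlinarith only [h1]
  have hN₂0 : 0 ≤ (KG * (j + C₄ * (ε₄ + a') ^ 2) + KA * (a' / (CH + 1)) + CG * Wc) * ε := by positivity
  have hNC : KA * ε * ((2097152 * ((d : ℝ) + 1) ^ 2) * (εC + aC) ^ 2) + CH * δC =
      (KA * ((2097152 * ((d : ℝ) + 1) ^ 2) * (εC + aC) ^ 2) + CH * (KC * rCm)) * ε := by rw [hδCdef]; ring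
  have h1 : 1 / DC * ((KG * ε * (j + C₄ * (ε₄ + a') ^ 2) + 0 * (ε₄ + a') + CG * (KW * ((KA' * ε * ((2097152 * ((d : ℝ) + 1) ^ 2) * (εC + aC) ^ 2) + CH * δC) / DC +
      (8 * (2097152 * ((d : ℝ) + 1) ^ 2) * (KA' * ε) + 8 * CH * δC / (εC + aC) ^ 2) * aC ^ 2 +
      524288 * Real.exp 4 * ((d - 1 : ℕ) : ℝ) * Λ ^ 2 * (L : ℝ) ^ (Finset.univ.sup lev₀) * ‖ρ‖ * ‖τc‖ * (1 / 16) ^ 2 * ε)) + KA * ε * ‖B‖) / D₂) ≤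
      (KG * (j + C₄ * (ε₄ + a') ^ 2) + KA * (a' / (CH + 1)) + CG * Wc) * ε / (DC * D₂) := by
    rw [one_div, inv_mul_eq_div, div_div, mul_comm D₂ DC]
    exact div_le_div_of_nonneg_right hN₂ hDD.le
  have h2 : (KA * ε * ((2097152 * ((d : ℝ) + 1) ^ 2) * (εC + aC) ^ 2) + CH * δC) / DC =
      (KA * ((2097152 * ((d : ℝ) + 1) ^ 2) * (εC + aC) ^ 2) + CH * (KC * rCm)) * ε / DC := by rw [hNC]
  refine (add_le_add h1 h2.le).trans ?_
  rw [hKndef]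
  have hε1 : 0 ≤ ε := hε
  have hA0 : 0 ≤ (KG * (j + C₄ * (ε₄ + a') ^ 2) + KA * (a' / (CH + 1)) + CG * Wc) / (DC * D₂) := by positivity
  have hB0 : 0 ≤ (KA * ((2097152 * ((d : ℝ) + 1) ^ 2) * (εC + aC) ^ 2) + CH * (KC * rCm)) / DC := by positivity
  have e1 : (KG * (j + C₄ * (ε₄ + a') ^ 2) + KA * (a' / (CH + 1)) + CG * Wc) * ε / (DC * D₂) =
      (KG * (j + C₄ * (ε₄ + a') ^ 2) + KA * (a' / (CH + 1)) + CG * Wc) / (DC * D₂) * ε := by ring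
  have e2 : (KA * ((2097152 * ((d : ℝ) + 1) ^ 2) * (εC + aC) ^ 2) + CH * (KC * rCm)) * ε / DC =
      (KA * ((2097152 * ((d : ℝ) + 1) ^ 2) * (εC + aC) ^ 2) + CH * (KC * rCm)) / DC * ε := by ring
  rw [e1, e2]
  nlinarith only [hA0, hB0, hε1]

end Summit.QuantumFields.BalabanUV.T4Continuum.NE9CurChartLipschitzAtFlatW80

end
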